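import Summits.BirchSwinnertonDyer.BirchSwinnertonDyer.Theorems.Rank2Observatory2DescKillQuartic

/-!
# BirchSwinnertonDyer — rank ≥ 2 observatory: KERNEL-2DESC kill layer (QK), from the quadric pair
# to the binary quartic through a rational point of the singular conic

HONEST FRAMING: per-curve certified theorems and census instruments; no claim on BSD in rank ≥ 2.

Generic file of the KERNEL-2DESC-CL "QK" kill layer (cert-1 gen 26), the ALGEBRAIC half. The
2-covering of a class `z` (`θ = t₀ + t₁α + t₂α²`) is `killQ = (q₁(r) + t₁n², q₂(r) + t₂n²) = 0`
(`Rank2Observatory2DescKillCheck`). The member `C = c₁q₁ + c₂q₂` of the pencil with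
`c₁t₁ + c₂t₂ = 0` does not involve `n`: it is a ternary CONIC, and every zero `(r, n)` of `killQ`
has `C(r) = 0`. Given an integer point `P₀` of the conic and a unimodular completion `[P₀ A B]`
(adjugate rows `ℓP, ℓA, ℓB`, determinant `D`), every integer zero `r` of `C` is, up to a scalar,
`Φ(u, v) = C(X)·P₀ − B_C(P₀, X)·X` with `X = uA + vB` (or the tangent value `Φ(β_B, −β_A) = R·P₀`);
substituting into `D_w = w₁q₁ + w₂q₂` (`τ = w₁t₁ + w₂t₂ ≠ 0`, `D_w(r) = −τn²`) gives
`G(u, v) := −τ·D_w(Φ(u, v)) = m²`. This file: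

* `cq`, `bq`, `lin3`, `phi`, `gcoef` — the conic, its polar form, `Φ`, and the five COEFFICIENTS of
  `G` computed from the data (`quartEval_gcoef : G(u,v) = −τ·D_w(Φ(u,v))`, a ring identity);
* `QKCert`, `qkCertCheck` — the per-class certificate `(c, w, P₀, A, B, D, ℓ, s, ĝ, fuel)` and its
  decidable side conditions (`c·t = 0`, `τ ≠ 0`, `C(P₀) = 0`, the nine adjugate identities, `D ≠ 0`,
  `R = C(β_B A − β_A B) ≠ 0`, `s ≠ 0`, `gcoef = s²·ĝ`), checked by `decide`;
* `qkCert_sound` — `qkCertCheck … Γ = true` and `qkCheck p Γ.g Γ.fuel = true`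
  (`Rank2Observatory2DescKillQuartic`) imply that `killQ` has NO integer zero primitive at `p` —
  literally the statement of `killCheck_sound`, so the row layers consume it unchanged
  (`KillValidAt`).

Elementary algebra over `ℤ` (parametrisation of a conic from a point, primitive parts, `a² ∣ b² ⇒
a ∣ b`); no `p`-adic numbers, no Hasse–Minkowski. References: J. W. S. Cassels, *Lectures on
Elliptic Curves* (1991), §§14–15 (the quadric-pair and quartic models of a 2-covering);
J. E. Cremona, *Algorithms for Modular Elliptic Curves* (1997), §3.6; B. J. Birch and
H. P. F. Swinnerton-Dyer, Notes on elliptic curves. I, J. reine angew. Math. 212 (1963) 7–25, §2.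
[cite: Cassels1991LecturesEllipticCurves, §15]
-/

set_option linter.dupNamespace false

namespace Summit.BirchSwinnertonDyer.BirchSwinnertonDyer.Rank2Observatory.TwoDescKill

/-! ### The conic of the pencil, its polar form, the parametrisation -/

section Ring

variable {R : Type*} [CommRing R]

/-- `uA + vB`, componentwise. [folklore] -/
def lin3 (u : R) (A : R × R × R) (v : R) (B : R × R × R) : R × R × R :=
  (u * A.1 + v * B.1, u * A.2.1 + v * B.2.1, u * A.2.2 + v * B.2.2)

/-- `αX + βY + γZ`, componentwise. [folklore] -/
def tri3 (α : R) (X : R × R × R) (β : R) (Y : R × R × R) (γ : R) (Z : R × R × R) : R × R × R :=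
  (α * X.1 + β * Y.1 + γ * Z.1, α * X.2.1 + β * Y.2.1 + γ * Z.2.1, α * X.2.2 + β * Y.2.2 + γ * Z.2.2)

/-- A six-term combination of vectors, componentwise. [folklore] -/
def comb6 (k₁ : R) (V₁ : R × R × R) (k₂ : R) (V₂ : R × R × R) (k₃ : R) (V₃ : R × R × R)
    (k₄ : R) (V₄ : R × R × R) (k₅ : R) (V₅ : R × R × R) (k₆ : R) (V₆ : R × R × R) : R × R × R :=
  (k₁ * V₁.1 + k₂ * V₂.1 + k₃ * V₃.1 + k₄ * V₄.1 + k₅ * V₅.1 + k₆ * V₆.1,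
    k₁ * V₁.2.1 + k₂ * V₂.2.1 + k₃ * V₃.2.1 + k₄ * V₄.2.1 + k₅ * V₅.2.1 + k₆ * V₆.2.1,
    k₁ * V₁.2.2 + k₂ * V₂.2.2 + k₃ * V₃.2.2 + k₄ * V₄.2.2 + k₅ * V₅.2.2 + k₆ * V₆.2.2)

/-- The linear functional `V ↦ c₁(zV)_α + c₂(zV)_{α²}` on the power basis. [folklore] -/
def lz (a b c : R) (z : R × R × R) (c₁ c₂ : R) (V : R × R × R) : R :=
  c₁ * (mul3 a b c z V).2.1 + c₂ * (mul3 a b c z V).2.2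

/-- Half the polar form of `c₁q₁ + c₂q₂`: `(r, s) ↦ c·(z r s)`. [folklore] -/
def hq (a b c : R) (z : R × R × R) (c₁ c₂ : R) (r s : R × R × R) : R :=
  lz a b c z c₁ c₂ (mul3 a b c r s)

/-- The member `c₁q₁ + c₂q₂` of the pencil: `r ↦ c₁(z r²)_α + c₂(z r²)_{α²}`.
[cite: Cassels1991LecturesEllipticCurves, §15] -/
def cq (a b c : R) (z : R × R × R) (c₁ c₂ : R) (r : R × R × R) : R := hq a b c z c₁ c₂ r r

/-- Its polar bilinear form `cq(r + s) − cq(r) − cq(s)`. [folklore] -/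
def bq (a b c : R) (z : R × R × R) (c₁ c₂ : R) (r s : R × R × R) : R := 2 * hq a b c z c₁ c₂ r s

/-- `cq` on a zero of `killQ`: `c₁q₁(r) + c₂q₂(r) = −(c₁t₁ + c₂t₂)n²`. [folklore] -/
theorem cq_killQ (a b c : R) (z : R × R × R) (c₁ c₂ t₁ t₂ r₀ r₁ r₂ n : R)
    (h : killQ a b c z t₁ t₂ (r₀, r₁, r₂, n) = 0) :
    cq a b c z c₁ c₂ (r₀, r₁, r₂) = -(c₁ * t₁ + c₂ * t₂) * n ^ 2 := by
  simp only [killQ, Prod.mk_eq_zero] at h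
  obtain ⟨h1, h2⟩ := h
  simp only [zsq] at h1 h2
  unfold cq hq lz
  linear_combination c₁ * h1 + c₂ * h2

/-- `cq(uA + vB) = u²cq(A) + uv·bq(A, B) + v²cq(B)`. [folklore] -/
theorem cq_lin3 (a b c : R) (z : R × R × R) (c₁ c₂ u : R) (A : R × R × R) (v : R) (B : R × R × R) :
    cq a b c z c₁ c₂ (lin3 u A v B) =
      u ^ 2 * cq a b c z c₁ c₂ A + u * v * bq a b c z c₁ c₂ A B + v ^ 2 * cq a b c z c₁ c₂ B := by
  simp only [cq, bq, hq, lz, lin3, mul3]; ring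

/-- `bq(P, uA + vB) = u·bq(P, A) + v·bq(P, B)`. [folklore] -/
theorem bq_lin3 (a b c : R) (z : R × R × R) (c₁ c₂ : R) (P : R × R × R) (u : R) (A : R × R × R)
    (v : R) (B : R × R × R) :
    bq a b c z c₁ c₂ P (lin3 u A v B) = u * bq a b c z c₁ c₂ P A + v * bq a b c z c₁ c₂ P B := by
  simp only [bq, hq, lz, lin3, mul3]; ring

/-- `cq` is homogeneous of degree `2`. [folklore] -/
theorem cq_smul3 (a b c : R) (z : R × R × R) (c₁ c₂ l x y w : R) :
    cq a b c z c₁ c₂ (l * x, l * y, l * w) = l ^ 2 * cq a b c z c₁ c₂ (x, y, w) := by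
  simp only [cq, hq, lz, mul3]; ring

/-- `(αX + βY + γZ)²` in `R[α]`, expanded. [folklore] -/
theorem mul3_tri3_sq (a b c α : R) (X : R × R × R) (β : R) (Y : R × R × R) (γ : R) (Z : R × R × R) :
    mul3 a b c (tri3 α X β Y γ Z) (tri3 α X β Y γ Z) =
      comb6 (α ^ 2) (mul3 a b c X X) (2 * α * β) (mul3 a b c X Y) (2 * α * γ) (mul3 a b c X Z)
        (β ^ 2) (mul3 a b c Y Y) (2 * β * γ) (mul3 a b c Y Z) (γ ^ 2) (mul3 a b c Z Z) := by
  simp only [mul3, tri3, comb6]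
  refine Prod.ext ?_ (Prod.ext ?_ ?_) <;> simp only <;> ring

/-- `lz` is linear. [folklore] -/
theorem lz_comb6 (a b c : R) (z : R × R × R) (c₁ c₂ : R) (k₁ : R) (V₁ : R × R × R) (k₂ : R)
    (V₂ : R × R × R) (k₃ : R) (V₃ : R × R × R) (k₄ : R) (V₄ : R × R × R) (k₅ : R) (V₅ : R × R × R)
    (k₆ : R) (V₆ : R × R × R) :
    lz a b c z c₁ c₂ (comb6 k₁ V₁ k₂ V₂ k₃ V₃ k₄ V₄ k₅ V₅ k₆ V₆) =
      k₁ * lz a b c z c₁ c₂ V₁ + k₂ * lz a b c z c₁ c₂ V₂ + k₃ * lz a b c z c₁ c₂ V₃ +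
        k₄ * lz a b c z c₁ c₂ V₄ + k₅ * lz a b c z c₁ c₂ V₅ + k₆ * lz a b c z c₁ c₂ V₆ := by
  simp only [lz, comb6, mul3]; ring

/-- `cq(u²X + uvY + v²Z)` is the binary quartic with coefficients
`(hq Z Z, 2hq Y Z, 2hq X Z + hq Y Y, 2hq X Y, hq X X)`. [folklore] -/
theorem cq_tri3 (a b c : R) (z : R × R × R) (c₁ c₂ : R) (X Y Z : R × R × R) (u v : R) :
    cq a b c z c₁ c₂ (tri3 (u ^ 2) X (u * v) Y (v ^ 2) Z) =
      quartEval (hq a b c z c₁ c₂ Z Z, 2 * hq a b c z c₁ c₂ Y Z,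
        2 * hq a b c z c₁ c₂ X Z + hq a b c z c₁ c₂ Y Y, 2 * hq a b c z c₁ c₂ X Y,
        hq a b c z c₁ c₂ X X) u v := by
  unfold cq hq
  rw [mul3_tri3_sq, lz_comb6]
  simp only [quartEval]
  ring

/-- `Φ(u, v) = cq(X)·P₀ − bq(P₀, X)·X`, `X = uA + vB`: the parametrisation of the conic `cq = 0`
from its point `P₀`. [cite: Cassels1991LecturesEllipticCurves, §15] -/
def phi (a b c : R) (z : R × R × R) (c₁ c₂ : R) (P₀ A B : R × R × R) (u v : R) : R × R × R :=
  lin3 (cq a b c z c₁ c₂ (lin3 u A v B)) P₀ (-(bq a b c z c₁ c₂ P₀ (lin3 u A v B))) (lin3 u A v B)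

/-- The `u²`- (with `A`) or `v²`- (with `B`) coefficient vector of `Φ`. [folklore] -/
def phi2 (a b c : R) (z : R × R × R) (c₁ c₂ : R) (P₀ A : R × R × R) : R × R × R :=
  lin3 (cq a b c z c₁ c₂ A) P₀ (-(bq a b c z c₁ c₂ P₀ A)) A

/-- The `uv`-coefficient vector of `Φ`. [folklore] -/
def phi11 (a b c : R) (z : R × R × R) (c₁ c₂ : R) (P₀ A B : R × R × R) : R × R × R :=
  tri3 (bq a b c z c₁ c₂ A B) P₀ (-(bq a b c z c₁ c₂ P₀ A)) B (-(bq a b c z c₁ c₂ P₀ B)) A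

/-- `Φ(u, v) = u²Φ₂ + uvΦ₁₁ + v²Φ₀`. [folklore] -/
theorem phi_eq (a b c : R) (z : R × R × R) (c₁ c₂ : R) (P₀ A B : R × R × R) (u v : R) :
    phi a b c z c₁ c₂ P₀ A B u v =
      tri3 (u ^ 2) (phi2 a b c z c₁ c₂ P₀ A) (u * v) (phi11 a b c z c₁ c₂ P₀ A B) (v ^ 2)
        (phi2 a b c z c₁ c₂ P₀ B) := by
  simp only [phi, cq_lin3, bq_lin3]
  simp only [phi2, phi11, lin3, tri3]
  refine Prod.ext ?_ (Prod.ext ?_ ?_) <;> simp only <;> ring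

/-- The five coefficients `(g₀, …, g₄)` (`gᵢ ↔ uⁱv⁴⁻ⁱ`) of `G(u, v) = −τ·D_w(Φ(u, v))`, computed
from the data. [folklore] -/
def gcoef (a b c : R) (z : R × R × R) (c₁ c₂ w₁ w₂ τ : R) (P₀ A B : R × R × R) :
    R × R × R × R × R :=
  let X := phi2 a b c z c₁ c₂ P₀ A
  let Y := phi11 a b c z c₁ c₂ P₀ A B
  let Z := phi2 a b c z c₁ c₂ P₀ B
  (-τ * hq a b c z w₁ w₂ Z Z, -τ * (2 * hq a b c z w₁ w₂ Y Z),
    -τ * (2 * hq a b c z w₁ w₂ X Z + hq a b c z w₁ w₂ Y Y), -τ * (2 * hq a b c z w₁ w₂ X Y),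
    -τ * hq a b c z w₁ w₂ X X)

/-- **The quartic by coefficients is the quartic by values**: `G(u, v) = −τ·D_w(Φ(u, v))`.
[folklore] -/
theorem quartEval_gcoef (a b c : R) (z : R × R × R) (c₁ c₂ w₁ w₂ τ : R) (P₀ A B : R × R × R)
    (u v : R) :
    quartEval (gcoef a b c z c₁ c₂ w₁ w₂ τ P₀ A B) u v =
      -τ * cq a b c z w₁ w₂ (phi a b c z c₁ c₂ P₀ A B u v) := by
  rw [phi_eq, cq_tri3]
  simp only [gcoef, quartEval]
  ring

/-- Scaling the coefficients scales the value. [folklore] -/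
theorem quartEval_coeff_smul (g : R × R × R × R × R) (l u v : R) :
    quartEval (l * g.1, l * g.2.1, l * g.2.2.1, l * g.2.2.2.1, l * g.2.2.2.2) u v =
      l * quartEval g u v := by
  simp only [quartEval]; ring

end Ring

/-! ### The certificate -/

/-- Per-class data of a QK kill: `(c₁, c₂)` with `c·t = 0` (the conic), `(w₁, w₂)` with
`τ = w·t ≠ 0`, a point `P₀` of the conic, a completion `[P₀ A B]` with adjugate rows `lP, lA, lB`
and determinant `D`, the square part `s` of the content of `G`, the reduced quartic `g = G/s²`, and
the fuel of the residue tree. [folklore] -/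
structure QKCert where
  (c₁ c₂ w₁ w₂ : ℤ)
  (P₀ A B : ℤ × ℤ × ℤ)
  (D : ℤ)
  (lP lA lB : ℤ × ℤ × ℤ)
  (s : ℤ)
  (g : ℤ × ℤ × ℤ × ℤ × ℤ)
  (fuel : ℕ)

/-- The nine identities `adj · [P₀ A B] = D·1`. [folklore] -/
def adjCheck (Γ : QKCert) : Bool :=
  decide (Γ.lP.1 * Γ.P₀.1 + Γ.lA.1 * Γ.A.1 + Γ.lB.1 * Γ.B.1 = Γ.D) &&
  decide (Γ.lP.2.1 * Γ.P₀.1 + Γ.lA.2.1 * Γ.A.1 + Γ.lB.2.1 * Γ.B.1 = 0) &&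
  decide (Γ.lP.2.2 * Γ.P₀.1 + Γ.lA.2.2 * Γ.A.1 + Γ.lB.2.2 * Γ.B.1 = 0) &&
  decide (Γ.lP.1 * Γ.P₀.2.1 + Γ.lA.1 * Γ.A.2.1 + Γ.lB.1 * Γ.B.2.1 = 0) &&
  decide (Γ.lP.2.1 * Γ.P₀.2.1 + Γ.lA.2.1 * Γ.A.2.1 + Γ.lB.2.1 * Γ.B.2.1 = Γ.D) &&
  decide (Γ.lP.2.2 * Γ.P₀.2.1 + Γ.lA.2.2 * Γ.A.2.1 + Γ.lB.2.2 * Γ.B.2.1 = 0) &&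
  decide (Γ.lP.1 * Γ.P₀.2.2 + Γ.lA.1 * Γ.A.2.2 + Γ.lB.1 * Γ.B.2.2 = 0) &&
  decide (Γ.lP.2.1 * Γ.P₀.2.2 + Γ.lA.2.1 * Γ.A.2.2 + Γ.lB.2.1 * Γ.B.2.2 = 0) &&
  decide (Γ.lP.2.2 * Γ.P₀.2.2 + Γ.lA.2.2 * Γ.A.2.2 + Γ.lB.2.2 * Γ.B.2.2 = Γ.D)

/-- **The QK certificate check** (all by `decide`): `c·t = 0`, `τ ≠ 0`, `cq(P₀) = 0`, the adjugate
identities, `D ≠ 0`, `R ≠ 0`, `s ≠ 0`, `gcoef = s²·g`. [folklore] -/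
def qkCertCheck (a b c : ℤ) (z : ℤ × ℤ × ℤ) (t₁ t₂ : ℤ) (Γ : QKCert) : Bool :=
  let bA := bq a b c z Γ.c₁ Γ.c₂ Γ.P₀ Γ.A
  let bB := bq a b c z Γ.c₁ Γ.c₂ Γ.P₀ Γ.B
  decide (Γ.c₁ * t₁ + Γ.c₂ * t₂ = 0) && decide (Γ.w₁ * t₁ + Γ.w₂ * t₂ ≠ 0) &&
  decide (cq a b c z Γ.c₁ Γ.c₂ Γ.P₀ = 0) && adjCheck Γ && decide (Γ.D ≠ 0) &&
  decide (cq a b c z Γ.c₁ Γ.c₂ (lin3 bB Γ.A (-bA) Γ.B) ≠ 0) && decide (Γ.s ≠ 0) &&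
  decide (gcoef a b c z Γ.c₁ Γ.c₂ Γ.w₁ Γ.w₂ (Γ.w₁ * t₁ + Γ.w₂ * t₂) Γ.P₀ Γ.A Γ.B =
    (Γ.s ^ 2 * Γ.g.1, Γ.s ^ 2 * Γ.g.2.1, Γ.s ^ 2 * Γ.g.2.2.1, Γ.s ^ 2 * Γ.g.2.2.2.1,
      Γ.s ^ 2 * Γ.g.2.2.2.2))

/-! ### Soundness -/

/-- If `κ²·s²·Ĝ(u, v)` is a square with `κ, s ≠ 0` and `(u, v) ≠ 0`, the primitive part of `(u, v)`
contradicts `qkCheck`. [folklore] -/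
theorem qk_no_square {p : ℕ} (hp : p.Prime) {g : ℤ × ℤ × ℤ × ℤ × ℤ} {fuel : ℕ}
    (hk : qkCheck p g fuel = true) {s κ u v M : ℤ} (hs : s ≠ 0) (hκ : κ ≠ 0)
    (huv : ¬ (u = 0 ∧ v = 0)) (h : κ ^ 2 * (s ^ 2 * quartEval g u v) = M * M) : False := by
  have hpZ : Prime (p : ℤ) := Nat.prime_iff_prime_int.mp hp
  obtain ⟨M₁, rfl⟩ : κ * s ∣ M := by
    rw [← Int.pow_dvd_pow_iff two_ne_zero]
    exact ⟨quartEval g u v, by linear_combination -h⟩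
  have hG : quartEval g u v = M₁ * M₁ := by
    have hks : (κ * s) ^ 2 ≠ 0 := pow_ne_zero _ (mul_ne_zero hκ hs)
    apply mul_left_cancel₀ hks
    linear_combination h
  obtain ⟨d, u', v', hd, hcop, hu, hv⟩ :=
    Int.exists_gcd_one' (Int.gcd_pos_iff.mpr (not_and_or.mp huv))
  have hprim : ¬ ((p : ℤ) ∣ u' ∧ (p : ℤ) ∣ v') := by
    rintro ⟨h1, h2⟩
    apply hpZ.not_dvd_one
    have e := Int.gcd_eq_gcd_ab u' v'
    rw [hcop] at e
    push_cast at e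
    rw [e]
    exact dvd_add (dvd_mul_of_dvd_left h1 _) (dvd_mul_of_dvd_left h2 _)
  have hG' : (d : ℤ) ^ 4 * quartEval g u' v' = M₁ * M₁ := by
    rw [← hG, hu, hv, mul_comm u' (d : ℤ), mul_comm v' (d : ℤ), quartEval_smul]
  obtain ⟨M₂, rfl⟩ : (d : ℤ) ^ 2 ∣ M₁ := by
    rw [← Int.pow_dvd_pow_iff two_ne_zero]
    exact ⟨quartEval g u' v', by linear_combination -hG'⟩
  have hd0 : (d : ℤ) ^ 4 ≠ 0 := pow_ne_zero _ (by exact_mod_cast hd.ne')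
  have hG'' : quartEval g u' v' = M₂ * M₂ := by
    apply mul_left_cancel₀ hd0
    linear_combination hG'
  exact qkCheck_sound hp hk u' v' M₂ hprim hG''

/-- **Soundness of the QK kill**: if the certificate checks and the residue tree of the reduced
quartic is certified at the prime `p`, then `killQ` has no integer zero primitive at `p` (the
2-covering of the class has no `ℚ_p`-point). Same statement as `killCheck_sound`.
[cite: Cassels1991LecturesEllipticCurves, §15] -/
theorem qkCert_sound {p : ℕ} (hp : p.Prime) {a b c : ℤ} {z : ℤ × ℤ × ℤ} {t₁ t₂ : ℤ} {Γ : QKCert}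
    (hc : qkCertCheck a b c z t₁ t₂ Γ = true) (hk : qkCheck p Γ.g Γ.fuel = true)
    (v : ℤ × ℤ × ℤ × ℤ)
    (hprim : ¬ ((p : ℤ) ∣ v.1 ∧ (p : ℤ) ∣ v.2.1 ∧ (p : ℤ) ∣ v.2.2.1 ∧ (p : ℤ) ∣ v.2.2.2))
    (h0 : killQ a b c z t₁ t₂ v = 0) : False := by
  obtain ⟨r₀, r₁, r₂, n⟩ := v
  dsimp only at hprim
  simp only [qkCertCheck, adjCheck, Bool.and_eq_true, decide_eq_true_eq] at hc
  obtain ⟨⟨⟨⟨⟨⟨⟨hct, hτ⟩, hP⟩, ⟨⟨⟨⟨⟨⟨⟨⟨e11, e21⟩, e31⟩, e12⟩, e22⟩, e32⟩, e13⟩, e23⟩, e33⟩⟩,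
    hD⟩, hR⟩, hs⟩, hg⟩ := hc
  -- name the certificate quantities
  obtain ⟨τ, hτd⟩ : ∃ x, Γ.w₁ * t₁ + Γ.w₂ * t₂ = x := ⟨_, rfl⟩
  obtain ⟨bA, hbA⟩ : ∃ x, bq a b c z Γ.c₁ Γ.c₂ Γ.P₀ Γ.A = x := ⟨_, rfl⟩
  obtain ⟨bB, hbB⟩ : ∃ x, bq a b c z Γ.c₁ Γ.c₂ Γ.P₀ Γ.B = x := ⟨_, rfl⟩
  obtain ⟨cA, hcA⟩ : ∃ x, cq a b c z Γ.c₁ Γ.c₂ Γ.A = x := ⟨_, rfl⟩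
  obtain ⟨cB, hcB⟩ : ∃ x, cq a b c z Γ.c₁ Γ.c₂ Γ.B = x := ⟨_, rfl⟩
  obtain ⟨cAB, hcAB⟩ : ∃ x, bq a b c z Γ.c₁ Γ.c₂ Γ.A Γ.B = x := ⟨_, rfl⟩
  rw [hbA, hbB] at hR
  obtain ⟨R, hRd⟩ : ∃ x, cq a b c z Γ.c₁ Γ.c₂ (lin3 bB Γ.A (-bA) Γ.B) = x := ⟨_, rfl⟩
  rw [hRd] at hR
  rw [hτd] at hτ hg
  -- the two quadrics through the conic and through `D_w`
  have hcr : cq a b c z Γ.c₁ Γ.c₂ (r₀, r₁, r₂) = 0 := by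
    rw [cq_killQ a b c z Γ.c₁ Γ.c₂ t₁ t₂ r₀ r₁ r₂ n h0, hct]; ring
  have hdr : cq a b c z Γ.w₁ Γ.w₂ (r₀, r₁, r₂) = -τ * n ^ 2 := by
    rw [cq_killQ a b c z Γ.w₁ Γ.w₂ t₁ t₂ r₀ r₁ r₂ n h0, hτd]
  -- `r ≠ 0`
  have hr0 : ¬ (r₀ = 0 ∧ r₁ = 0 ∧ r₂ = 0) := by
    rintro ⟨e0, e1, e2⟩
    subst e0 e1 e2
    have hn : ¬ (p : ℤ) ∣ n := fun hn => hprim ⟨dvd_zero _, dvd_zero _, dvd_zero _, hn⟩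
    have hn2 : n ^ 2 ≠ 0 := pow_ne_zero _ (fun h => hn (h ▸ dvd_zero _))
    have hz : cq a b c z Γ.w₁ Γ.w₂ ((0 : ℤ), (0 : ℤ), (0 : ℤ)) = 0 := by
      simp [cq, hq, lz, mul3]
    rw [hz] at hdr
    exact hτ ((mul_eq_zero.mp (by linear_combination hdr : τ * n ^ 2 = 0)).resolve_right hn2)
  -- the adjugate decomposition `D·r = κ·P₀ + u₁·A + v₁·B`
  obtain ⟨κ, hκ⟩ : ∃ x, Γ.lP.1 * r₀ + Γ.lP.2.1 * r₁ + Γ.lP.2.2 * r₂ = x := ⟨_, rfl⟩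
  obtain ⟨u₁, hu₁⟩ : ∃ x, Γ.lA.1 * r₀ + Γ.lA.2.1 * r₁ + Γ.lA.2.2 * r₂ = x := ⟨_, rfl⟩
  obtain ⟨v₁, hv₁⟩ : ∃ x, Γ.lB.1 * r₀ + Γ.lB.2.1 * r₁ + Γ.lB.2.2 * r₂ = x := ⟨_, rfl⟩
  have d1 : Γ.D * r₀ = κ * Γ.P₀.1 + (u₁ * Γ.A.1 + v₁ * Γ.B.1) := by
    rw [← hκ, ← hu₁, ← hv₁]; linear_combination -(r₀ * e11 + r₁ * e21 + r₂ * e31)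
  have d2 : Γ.D * r₁ = κ * Γ.P₀.2.1 + (u₁ * Γ.A.2.1 + v₁ * Γ.B.2.1) := by
    rw [← hκ, ← hu₁, ← hv₁]; linear_combination -(r₀ * e12 + r₁ * e22 + r₂ * e32)
  have d3 : Γ.D * r₂ = κ * Γ.P₀.2.2 + (u₁ * Γ.A.2.2 + v₁ * Γ.B.2.2) := by
    rw [← hκ, ← hu₁, ← hv₁]; linear_combination -(r₀ * e13 + r₁ * e23 + r₂ * e33)
  obtain ⟨β, hβ⟩ : ∃ x, bq a b c z Γ.c₁ Γ.c₂ Γ.P₀ (lin3 u₁ Γ.A v₁ Γ.B) = x := ⟨_, rfl⟩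
  obtain ⟨γ, hγ⟩ : ∃ x, cq a b c z Γ.c₁ Γ.c₂ (lin3 u₁ Γ.A v₁ Γ.B) = x := ⟨_, rfl⟩
  have eβ : β = u₁ * bA + v₁ * bB := by rw [← hβ, bq_lin3, hbA, hbB]
  have eγ : γ = u₁ ^ 2 * cA + u₁ * v₁ * cAB + v₁ ^ 2 * cB := by rw [← hγ, cq_lin3, hcA, hcB, hcAB]
  have eR : R = bB ^ 2 * cA + bB * (-bA) * cAB + (-bA) ^ 2 * cB := by
    rw [← hRd, cq_lin3, hcA, hcB, hcAB]
  have hDr : ((Γ.D * r₀, Γ.D * r₁, Γ.D * r₂) : ℤ × ℤ × ℤ) = lin3 κ Γ.P₀ 1 (lin3 u₁ Γ.A v₁ Γ.B) := by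
    rw [d1, d2, d3]
    simp only [lin3, Prod.mk.injEq]
    exact ⟨by ring, by ring, by ring⟩
  -- `cq(X) = −κβ`
  have hγκ : γ + κ * β = 0 := by
    have h1 := cq_smul3 a b c z Γ.c₁ Γ.c₂ Γ.D r₀ r₁ r₂
    rw [hDr, cq_lin3, hP, hβ, hγ, hcr] at h1
    linear_combination h1
  -- `Φ(u₁, v₁) = −βD·r`
  have hphi : phi a b c z Γ.c₁ Γ.c₂ Γ.P₀ Γ.A Γ.B u₁ v₁ =
      (-(β * Γ.D) * r₀, -(β * Γ.D) * r₁, -(β * Γ.D) * r₂) := by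
    unfold phi
    rw [hβ, hγ]
    simp only [lin3, Prod.mk.injEq]
    exact ⟨by linear_combination Γ.P₀.1 * hγκ + β * d1,
      by linear_combination Γ.P₀.2.1 * hγκ + β * d2,
      by linear_combination Γ.P₀.2.2 * hγκ + β * d3⟩
  -- `s²·Ĝ(u₁, v₁) = (τβDn)²`
  have hG1 : Γ.s ^ 2 * quartEval Γ.g u₁ v₁ = (τ * β * Γ.D * n) ^ 2 := by
    have e1 := quartEval_gcoef a b c z Γ.c₁ Γ.c₂ Γ.w₁ Γ.w₂ τ Γ.P₀ Γ.A Γ.B u₁ v₁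
    rw [hg, quartEval_coeff_smul, hphi, cq_smul3, hdr] at e1
    linear_combination e1
  by_cases hβ0 : β = 0
  · -- tangent case: `X = 0`, `D·r = κ·P₀`, use `Φ(β_B, −β_A) = R·P₀`
    have hγ0 : γ = 0 := by linear_combination hγκ - κ * hβ0
    have hX1 : u₁ * bA + v₁ * bB = 0 := by rw [← eβ, hβ0]
    have hX2 : u₁ ^ 2 * cA + u₁ * v₁ * cAB + v₁ ^ 2 * cB = 0 := by rw [← eγ, hγ0]
    have hu0 : u₁ = 0 := by
      have h : u₁ ^ 2 * R = 0 := by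
        rw [eR]
        linear_combination bB ^ 2 * hX2 + (-(u₁ * bB * cAB) + cB * (u₁ * bA - v₁ * bB)) * hX1
      exact (pow_eq_zero_iff two_ne_zero).mp ((mul_eq_zero.mp h).resolve_right hR)
    have hv0 : v₁ = 0 := by
      have h : v₁ ^ 2 * R = 0 := by
        rw [eR]
        linear_combination bA ^ 2 * hX2 + (cA * (v₁ * bB - u₁ * bA) - v₁ * bA * cAB) * hX1
      exact (pow_eq_zero_iff two_ne_zero).mp ((mul_eq_zero.mp h).resolve_right hR)
    subst hu0 hv0
    have k1 : Γ.D * r₀ = κ * Γ.P₀.1 := by rw [d1]; ring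
    have k2 : Γ.D * r₁ = κ * Γ.P₀.2.1 := by rw [d2]; ring
    have k3 : Γ.D * r₂ = κ * Γ.P₀.2.2 := by rw [d3]; ring
    have hκ0 : κ ≠ 0 := by
      intro hκ0
      rw [hκ0, zero_mul] at k1 k2 k3
      exact hr0 ⟨(mul_eq_zero.mp k1).resolve_left hD, (mul_eq_zero.mp k2).resolve_left hD,
        (mul_eq_zero.mp k3).resolve_left hD⟩
    have huv : ¬ (bB = 0 ∧ -bA = 0) := by
      rintro ⟨h1, h2⟩
      apply hR
      rw [eR, h1, neg_eq_zero.mp h2]; ring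
    have hphiT : phi a b c z Γ.c₁ Γ.c₂ Γ.P₀ Γ.A Γ.B bB (-bA) =
        (R * Γ.P₀.1, R * Γ.P₀.2.1, R * Γ.P₀.2.2) := by
      unfold phi
      rw [bq_lin3, hbA, hbB, hRd]
      simp only [lin3, Prod.mk.injEq]
      exact ⟨by ring, by ring, by ring⟩
    have e2 : κ ^ 2 * cq a b c z Γ.w₁ Γ.w₂ Γ.P₀ = Γ.D ^ 2 * (-τ * n ^ 2) := by
      have h1 := cq_smul3 a b c z Γ.w₁ Γ.w₂ Γ.D r₀ r₁ r₂
      have h2 := cq_smul3 a b c z Γ.w₁ Γ.w₂ κ Γ.P₀.1 Γ.P₀.2.1 Γ.P₀.2.2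
      rw [k1, k2, k3, h2, hdr] at h1
      simpa only [Prod.mk.eta] using h1
    have hG2 : κ ^ 2 * (Γ.s ^ 2 * quartEval Γ.g bB (-bA)) =
        (τ * R * Γ.D * n) * (τ * R * Γ.D * n) := by
      have e1 := quartEval_gcoef a b c z Γ.c₁ Γ.c₂ Γ.w₁ Γ.w₂ τ Γ.P₀ Γ.A Γ.B bB (-bA)
      rw [hg, quartEval_coeff_smul, hphiT, cq_smul3] at e1
      simp only [Prod.mk.eta] at e1
      linear_combination κ ^ 2 * e1 - τ * R ^ 2 * e2
    exact qk_no_square hp hk hs hκ0 huv hG2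
  · -- generic case: `(u₁, v₁) ≠ 0` and `s²·Ĝ(u₁, v₁)` is a square
    have huv : ¬ (u₁ = 0 ∧ v₁ = 0) := by
      rintro ⟨h1, h2⟩; apply hβ0; rw [eβ, h1, h2]; ring
    have hG2 : (1 : ℤ) ^ 2 * (Γ.s ^ 2 * quartEval Γ.g u₁ v₁) =
        (τ * β * Γ.D * n) * (τ * β * Γ.D * n) := by
      linear_combination hG1
    exact qk_no_square hp hk hs one_ne_zero huv hG2

end Summit.BirchSwinnertonDyer.BirchSwinnertonDyer.Rank2Observatory.TwoDescKill
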